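import Summits.KontsevichZagierPeriods.Zeta5Search.LaiSweepShard

/-!
# `κ₃` sweep certificate — shard file 015 of 127 (shards 105–111 of 889)

HONEST FRAMING. Systematic search; no irrationality claim unless certified. This file only checks,
by `decide +kernel`, shards 105–111 of the order-cell sweep of the `κ₃` point `(74, 2180, 444; δ74)`
(engine `LaiSweepEngine`, soundness `LaiSweepJump/Free/Eval/Shard/Kappa3`; a shard is `⟨regime, n,
p, q, p', q', Lo, Up⟩`: `n` cells from `p/q` to `p'/q'` with integer rate sums in `[Lo, Up]`, `K =
128`, `D = 2^40`). It draws NO conclusion: only the capstone `LaiKappa3SweepCert`, which needs all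
127 shard files, does. Kernel cost of this file ≈ 560 cells × 0.3 s.
-/

namespace Summit.KontsevichZagierPeriods.Zeta5Search.Sweep

set_option maxHeartbeats 100000000 in
/-- Shard 105: 80 cells of regime A from `61/2230` to `35/1268`.
[cite: Lai2024BallRivoal, §4 Lemma 4.3] -/
theorem shard105 :
    Shard.check 128 (2^40)
      ⟨false, 80, 61, 2230, 35, 1268, 52796834704758, 52823333586230⟩ = true := by
  decide +kernel

set_option maxHeartbeats 100000000 in
/-- Shard 106: 80 cells of regime A from `35/1268` to `9/323`.
[cite: Lai2024BallRivoal, §4 Lemma 4.3] -/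
theorem shard106 :
    Shard.check 128 (2^40)
      ⟨false, 80, 35, 1268, 9, 323, 57023582633039, 57056756914938⟩ = true := by
  decide +kernel

set_option maxHeartbeats 100000000 in
/-- Shard 107: 80 cells of regime A from `9/323` to `71/2528`.
[cite: Lai2024BallRivoal, §4 Lemma 4.3] -/
theorem shard107 :
    Shard.check 128 (2^40)
      ⟨false, 80, 9, 323, 71, 2528, 48972720087443, 48996481297757⟩ = true := by
  decide +kernel

set_option maxHeartbeats 100000000 in
/-- Shard 108: 80 cells of regime A from `71/2528` to `63/2224`.
[cite: Lai2024BallRivoal, §4 Lemma 4.3] -/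
theorem shard108 :
    Shard.check 128 (2^40)
      ⟨false, 80, 71, 2528, 63, 2224, 52338288817072, 52364343552546⟩ = true := by
  decide +kernel

set_option maxHeartbeats 100000000 in
/-- Shard 109: 80 cells of regime A from `63/2224` to `63/2204`.
[cite: Lai2024BallRivoal, §4 Lemma 4.3] -/
theorem shard109 :
    Shard.check 128 (2^40)
      ⟨false, 80, 63, 2224, 63, 2204, 54751310602325, 54780430225690⟩ = true := by
  decide +kernel

set_option maxHeartbeats 100000000 in
/-- Shard 110: 80 cells of regime A from `63/2204` to `73/2534`.
[cite: Lai2024BallRivoal, §4 Lemma 4.3] -/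
theorem shard110 :
    Shard.check 128 (2^40)
      ⟨false, 80, 63, 2204, 73, 2534, 46586193703716, 46609591898426⟩ = true := by
  decide +kernel

set_option maxHeartbeats 100000000 in
/-- Shard 111: 80 cells of regime A from `73/2534` to `76/2615`.
[cite: Lai2024BallRivoal, §4 Lemma 4.3] -/
theorem shard111 :
    Shard.check 128 (2^40)
      ⟨false, 80, 73, 2534, 76, 2615, 52169357681594, 52196223123815⟩ = true := by
  decide +kernel

/-- The checked shards of this file, in order. [folklore] -/
def shards015 : List (CheckedShard 128 (2^40)) :=
  [⟨_, shard105⟩, ⟨_, shard106⟩, ⟨_, shard107⟩, ⟨_, shard108⟩, ⟨_, shard109⟩,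
    ⟨_, shard110⟩, ⟨_, shard111⟩]

end Summit.KontsevichZagierPeriods.Zeta5Search.Sweep
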